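import Mathlib.Analysis.Calculus.Deriv.Mul
import Mathlib.Analysis.Calculus.Deriv.Add
import Mathlib.Analysis.Complex.RealDeriv
import Mathlib.Analysis.CStarAlgebra.Matrix
import Mathlib.LinearAlgebra.Eigenspace.Basic

/-!
# Route `BalabanIR`, crux 5 `BirEveryGroundState` (`stmt-HubbardSuperconductivity-2083`):
# the SPECTRAL-CURVE toolkit, II (Theses-free) — Kato isotropy and Shastry pairing

The two MECHANISM lemmas behind the crux idea cards `spectral-curve-anchor` (glue `KatoIsotropy`)
and `nonintegrability-severs-parity-pairing` (first lemma `ShastryPairing`), crux-ideate round 1,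
ideator 2 — proved unconditionally, importing NO route file (rev-5 materialisation rule).
Companion of `BalabanIRBirEveryGroundStateSpectralCurve.lean`.

* `katoIsotropy` — along a differentiable family of eigenprojections `P(U)` of the affine pencil
  `T + U • D` with eigenvalue `e(U)`, the compression of the coupling operator is scalar,
  `P(U₀) D P(U₀) = e'(U₀) P(U₀)` (differentiate `(T + U D) P = e P`, multiply by `P(U₀)` on the
  left, use the two-sided relation at `U₀`). On an interval-permanent ground multiplet (Kato: the
  total projection is analytic) every ground state, bright or dark, has the SAME double occupancy
  and `D` has no matrix element between them — the fingerprint a refuter can hunt.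
* `shastryPairing` — a `U`-linear conserved current `I(U) = I₀ + U • I₁` of the pencil that
  ANTIcommutes with a symmetry `σ` maps `σ = +1` eigenvectors of `T + U • D` to `σ = -1`
  eigenvectors with the same eigenvalue, for every `U` at once: the Heilmann–Lieb /
  Yuzbashyan–Altshuler–Shastry engine of permanent inter-parity-block degeneracy (a common factor
  of the two parity blocks' characteristic polynomials whenever `I(U) v ≠ 0`);
  `shastryPairing_two_le_finrank` — hence a level of multiplicity `≥ 2` at every such `U`.

Sources: Kato, *Perturbation Theory for Linear Operators* (1966) II §§1.4, 2.3; Heilmann–Lieb,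
Ann. N.Y. Acad. Sci. 172 (1971) 584; Yuzbashyan–Altshuler–Shastry, J. Phys. A 35 (2002) 7525,
§5. Folklore linear algebra; no definition is introduced.
-/

noncomputable section

namespace Summit.HubbardSuperconductivity.HubbardSuperconductivity.Theorems

open Matrix

section Kato

open scoped Matrix.Norms.L2Operator
open Filter Topology

variable {n : Type*} [Fintype n] [DecidableEq n]

/-- **Kato isotropy** (`KatoIsotropy`, derivative form). Along a differentiable family of
projections `P(U)` (`P(U₀)² = P(U₀)`) that are eigenprojections of the affine pencil,
`(T + U • D) P(U) = e(U) P(U)` near `U₀`, with the two-sided relation `P(U₀) (T + U₀ • D) =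
e(U₀) P(U₀)` at `U₀` (automatic when `T, D, P(U₀)` are Hermitian and `e(U₀)` is real), the
compression of the coupling operator is SCALAR: `P(U₀) D P(U₀) = e'(U₀) P(U₀)`. (Differentiate
the eigen-relation — product rule for matrix-valued maps in the `L²`-operator norm — and multiply
by `P(U₀)` on the left.) On an interval-permanent ground multiplet (Kato: the total projection is
analytic) this says that every ground state, bright or dark, has the SAME double occupancy
`e'(U₀)` and that `D` has no matrix elements between them. Kato (1966) II §§1.4, 2.3, (2.38)–(2.40);
Hellmann–Feynman. [folklore] -/
theorem katoIsotropy (T D : Matrix n n ℂ) {P : ℝ → Matrix n n ℂ} {e : ℝ → ℂ} {U₀ : ℝ}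
    {P' : Matrix n n ℂ} {e' : ℂ} (hP : HasDerivAt P P' U₀) (he : HasDerivAt e e' U₀)
    (hPP : P U₀ * P U₀ = P U₀)
    (heig : ∀ᶠ U : ℝ in 𝓝 U₀, (T + (↑U : ℂ) • D) * P U = e U • P U)
    (heig' : P U₀ * (T + (U₀ : ℂ) • D) = e U₀ • P U₀) :
    P U₀ * D * P U₀ = e' • P U₀ := by
  have hH : HasDerivAt (fun U : ℝ => T + (U : ℂ) • D) D U₀ := by
    have h1 : HasDerivAt (fun U : ℝ => ((id U : ℝ) : ℂ)) (1 : ℝ) U₀ :=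
      (hasDerivAt_id U₀).ofReal_comp
    have h2 := (h1.smul_const D).const_add T
    simpa using h2
  have hL : HasDerivAt (fun U : ℝ => (T + (U : ℂ) • D) * P U)
      (D * P U₀ + (T + (U₀ : ℂ) • D) * P') U₀ := hH.mul hP
  have hR : HasDerivAt (fun U : ℝ => e U • P U) (e U₀ • P' + e' • P U₀) U₀ := he.smul hP
  have hL' : HasDerivAt (fun U : ℝ => e U • P U) (D * P U₀ + (T + (U₀ : ℂ) • D) * P') U₀ :=
    hL.congr_of_eventuallyEq (heig.mono fun U hU => hU.symm)
  have hEq : D * P U₀ + (T + (U₀ : ℂ) • D) * P' = e U₀ • P' + e' • P U₀ := hL'.unique hR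
  have h2 := congrArg (fun M => P U₀ * M) hEq
  simp only [mul_add, Matrix.mul_smul, ← mul_assoc, heig', Matrix.smul_mul, hPP] at h2
  -- h2 : P U₀ * D * P U₀ + e U₀ • (P U₀ * P') = e U₀ • (P U₀ * P') + e' • P U₀
  rw [add_comm (e U₀ • (P U₀ * P'))] at h2
  exact add_right_cancel h2

end Kato

section Shastry

variable {n : Type*} [Fintype n] [DecidableEq n]

/-- **Shastry pairing** (`ShastryPairing` of the crux card
`nonintegrability-severs-parity-pairing`). Let `I(U) = I₀ + U • I₁` be a `U`-linear current
conserved by the pencil degree by degree (`[I₀, T] = 0`, `[I₁, D] = 0`, `[I₀, D] + [I₁, T] = 0`,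
i.e. `[I(U), T + U • D] = 0` for every `U`) and ANTIcommuting with a matrix `σ`. Then `I(U)` maps
every `σ = +1` eigenvector of `T + U • D` with eigenvalue `μ` to a `σ = -1` eigenvector with the
same eigenvalue — the Heilmann–Lieb / Yuzbashyan–Altshuler–Shastry mechanism of PERMANENT
(all-`U`) inter-parity-block degeneracy (whenever `I(U) v ≠ 0`). The card's printed form also
assumes `σ² = 1`, `[σ, T] = [σ, D] = 0` (so that `σ = ±1` label blocks of the pencil); these are
not needed for the conclusion and are dropped. Heilmann–Lieb (1971); Yuzbashyan–Altshuler–Shastry,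
J. Phys. A 35 (2002) 7525, §5, eqs. (I2psi), (Zphi). [folklore] -/
theorem shastryPairing (T D I₀ I₁ σ : Matrix n n ℂ) (h₀ : Commute I₀ T) (h₁ : Commute I₁ D)
    (hmix : (I₀ * D - D * I₀) + (I₁ * T - T * I₁) = 0)
    (ha₀ : σ * I₀ = -(I₀ * σ)) (ha₁ : σ * I₁ = -(I₁ * σ)) (U μ : ℂ) (v : n → ℂ)
    (hv : (T + U • D) *ᵥ v = μ • v) (hσv : σ *ᵥ v = v) :
    (T + U • D) *ᵥ ((I₀ + U • I₁) *ᵥ v) = μ • ((I₀ + U • I₁) *ᵥ v) ∧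
      σ *ᵥ ((I₀ + U • I₁) *ᵥ v) = -((I₀ + U • I₁) *ᵥ v) := by
  have hcomm : (T + U • D) * (I₀ + U • I₁) = (I₀ + U • I₁) * (T + U • D) := by
    have e₀ : T * I₀ = I₀ * T := h₀.eq.symm
    have e₁ : D * I₁ = I₁ * D := h₁.eq.symm
    have e₂ : T * I₁ + D * I₀ = I₀ * D + I₁ * T := by
      rw [← sub_eq_zero, ← neg_eq_zero, ← hmix]; abel
    calc (T + U • D) * (I₀ + U • I₁)
        = T * I₀ + U • (T * I₁ + D * I₀) + (U * U) • (D * I₁) := by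
          simp only [add_mul, mul_add, smul_mul_assoc, mul_smul_comm, smul_add, smul_smul]; abel
      _ = I₀ * T + U • (I₀ * D + I₁ * T) + (U * U) • (I₁ * D) := by rw [e₀, e₁, e₂]
      _ = (I₀ + U • I₁) * (T + U • D) := by
          simp only [add_mul, mul_add, smul_mul_assoc, mul_smul_comm, smul_add, smul_smul]; abel
  have hanti : σ * (I₀ + U • I₁) = -((I₀ + U • I₁) * σ) := by
    rw [mul_add, mul_smul_comm, ha₀, ha₁, add_mul, smul_mul_assoc, neg_add, smul_neg]
  constructor
  · rw [mulVec_mulVec, hcomm, ← mulVec_mulVec, hv, mulVec_smul]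
  · rw [mulVec_mulVec, hanti, neg_mulVec, ← mulVec_mulVec, hσv]


/-- **Shastry pairing forces a degenerate level.** In the situation of `shastryPairing`, if the
paired vector `I(U) v` is nonzero then `v` (`σ = +1`) and `I(U) v` (`σ = -1`) are linearly
independent eigenvectors of `T + U • D` with the same eigenvalue `μ`, so the level `μ` is at least
doubly degenerate — at EVERY coupling `U` where `I(U) v(U) ≠ 0`; fed into
`IsHermitian.finite_setOf_degenerate_of_anchor` (companion file) this is incompatible with `μ(U)`
lying on an anchored component for infinitely many `U`. [folklore] -/
theorem shastryPairing_two_le_finrank (T D I₀ I₁ σ : Matrix n n ℂ) (h₀ : Commute I₀ T)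
    (h₁ : Commute I₁ D) (hmix : (I₀ * D - D * I₀) + (I₁ * T - T * I₁) = 0)
    (ha₀ : σ * I₀ = -(I₀ * σ)) (ha₁ : σ * I₁ = -(I₁ * σ)) (U μ : ℂ) (v : n → ℂ)
    (hv : (T + U • D) *ᵥ v = μ • v) (hσv : σ *ᵥ v = v) (hv0 : v ≠ 0)
    (hIv : (I₀ + U • I₁) *ᵥ v ≠ 0) :
    2 ≤ Module.finrank ℂ (Module.End.eigenspace (Matrix.toLin' (T + U • D)) μ) := by
  obtain ⟨hw, hσw⟩ := shastryPairing T D I₀ I₁ σ h₀ h₁ hmix ha₀ ha₁ U μ v hv hσv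
  set w := (I₀ + U • I₁) *ᵥ v with hw_def
  -- `v` and `w` are linearly independent (`σ`-eigenvalues `+1 ≠ -1`)
  have hli : LinearIndependent ℂ ![v, w] := by
    rw [LinearIndependent.pair_iff]
    intro s t hst
    have h1 : σ *ᵥ (s • v + t • w) = 0 := by rw [hst, mulVec_zero]
    rw [mulVec_add, mulVec_smul, mulVec_smul, hσv, hσw, smul_neg] at h1
    -- h1 : s • v + -(t • w) = 0, hst : s • v + t • w = 0
    have hs : (2 * s) • v = 0 := by
      have := congrArg₂ (· + ·) hst h1
      simp only [add_zero] at this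
      rw [mul_smul, two_smul, ← this]; abel
    have hs0 : s = 0 := by
      rcases smul_eq_zero.mp hs with h | h
      · simpa using h
      · exact absurd h hv0
    refine ⟨hs0, ?_⟩
    rw [hs0, zero_smul, zero_add] at hst
    rcases smul_eq_zero.mp hst with h | h
    · exact h
    · exact absurd h hIv
  -- both lie in the eigenspace
  have hv' : v ∈ Module.End.eigenspace (Matrix.toLin' (T + U • D)) μ := by
    simpa only [Module.End.mem_eigenspace_iff, Matrix.toLin'_apply] using hv
  have hw' : w ∈ Module.End.eigenspace (Matrix.toLin' (T + U • D)) μ := by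
    simpa only [Module.End.mem_eigenspace_iff, Matrix.toLin'_apply] using hw
  have hmem : ∀ i, ![v, w] i ∈ Module.End.eigenspace (Matrix.toLin' (T + U • D)) μ := by
    rw [Fin.forall_fin_two]
    exact ⟨hv', hw'⟩
  have hspan : Submodule.span ℂ (Set.range ![v, w]) ≤
      Module.End.eigenspace (Matrix.toLin' (T + U • D)) μ :=
    Submodule.span_le.mpr (Set.range_subset_iff.mpr hmem)
  calc 2 = Fintype.card (Fin 2) := (Fintype.card_fin 2).symm
    _ = Module.finrank ℂ (Submodule.span ℂ (Set.range ![v, w])) :=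
        (finrank_span_eq_card hli).symm
    _ ≤ _ := Submodule.finrank_mono hspan

end Shastry

end Summit.HubbardSuperconductivity.HubbardSuperconductivity.Theorems
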